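import Literature.Analysis.FluidPDE.NormalisedPressureLpBoundProofs
import Literature.Analysis.SingularIntegrals.CalderonZygmundLpNearOne
import HarnessLib

/-!
# The `L^p` bound for the normalised pressure near `p = 1`: `‖p̃[w]‖_p ≤ C₀ (p−1)⁻¹ ‖|w|²‖_p`

Analysis/FluidPDE proof file; sibling of `NormalisedPressureLpBound` (the named fact
`stein1970_normalisedPressure_Lp_bound`: for each `1 < p < ∞` SOME constant `C(p)`) and of its
discharge `NormalisedPressureLpBoundProofs` (`stein1970_normalisedPressure_Lp_bound_holds`). This
file PROVES the same bound WITH THE SHAPE OF THE CONSTANT as `p ↓ 1`: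

**Stein 1970, Ch. II §6.2 (a)** (for the operators of Ch. II Theorems 1–3, here the nine
Riesz-type kernels `Kᵢⱼ = Ωᵢⱼ(z/|z|)/|z|³` of the normalised pressure
`p̃[w] = -Σᵢⱼ RᵢRⱼ(wᵢwⱼ)`, Tao 2011 (35)): *"If `A_p` is the `L^p` bound for `T` in Theorem 1, 2,
or 3, then `A_p ≤ A/(p−1)` for `1 < p ≤ 2`"*. Concretely (`exists_eLpNorm_normalisedPressure_le_near_one`):
there is ONE constant `C₀` with

  `‖p̃[w]‖_{L^p} ≤ C₀ (p − 1)⁻¹ ‖|w|²‖_{L^p}`  for all `1 < p ≤ 2` and all `w ∈ C^∞_c(ℝ³; ℝ³)`.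

This is the input of the `L log L → L¹_loc` estimate for `p̃[w]` (Stein 1970, Ch. II §6.2 (b);
the choice `p − 1 = 1/log(…)` converts `(p−1)⁻¹` into a logarithm), used on the `ns` side as the
statement `SteinNearOne` of the instrument «pressure budget with a logarithm» (nsreg cell,
2026-08-29); the statement below is literally that text.

## The argument

Exactly the chain of `NormalisedPressureLpBoundProofs` with the constant tracked:
* §1 the uniform near-`1` Calderón–Zygmund theorem
  (`SingularIntegrals.exists_eLpNorm_le_near_one`: Marcinkiewicz between the weak type `(1,1)`
  and the proved type `(4,4)`, `n = 3`, `A = 4M_λ`, `B` the uniform Hörmander bound of the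
  regularised Hessian kernels `k^a_ε = ∂ₐ∂ₐΦ_ε`) gives ONE `C` with
  `‖H^a_ε[h]‖_p ≤ C (p−1)⁻¹ ‖h‖_p` for all `1 < p ≤ 2`, `ε > 0`, `|a| ≤ 2`, `h ∈ C_c`
  (`exists_eLpNorm_hessConv_le_near_one`);
* §2 polarisation `Q_ε = -½Σᵢⱼ(H^{bᵢ+bⱼ} − H^{bᵢ} − H^{bⱼ})[wᵢwⱼ]`, parametric in the
  Hessian-convolution constant (`eLpNorm_regPressure_le_of_hessConv_le`: constant `K ↦ 27K`);
* §3 Fatou along `ε = 1/(n+1)` (`p̃[w] = lim Q_ε[w]` pointwise).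

## Contents

* `exists_eLpNorm_hessConv_le_near_one`, `eLpNorm_regPressure_le_of_hessConv_le` (tools);
* `exists_eLpNorm_normalisedPressure_le_near_one` — **the theorem** (`p : ℝ≥0∞`, `1 < p ≤ 2`);
* `exists_eLpNorm_normalisedPressure_le_one_add` — the same with `p = 1 + s`, `0 < s ≤ 1`, and the
  constant written `C₀ s⁻¹` (the form the `L log L` optimisation in `s` consumes).

No definitions, no named facts; standard axioms.

## References

* E. M. Stein, *Singular integrals and differentiability properties of functions*, Princeton
  Math. Series 30 (1970): Ch. II §6.2 (a) (the bound `A_p ≤ A/(p−1)`, `1 < p ≤ 2`), §4.2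
  Theorem 3 (the kernels `Ω(z/|z|)/|z|ⁿ`), Ch. I §4.3 (the Marcinkiewicz constant). [`Stein1971`]
* T. Tao, *Localisation and compactness properties of the Navier–Stokes global regularity
  problem*, Anal. PDE 6 (2013) = arXiv:1108.1165, (35) (the normalised pressure). [`Tao2011`]
-/

noncomputable section

open MeasureTheory Set Filter Topology Function Metric
open scoped ENNReal NNReal RealInnerProductSpace ContDiff

namespace Literature.Analysis.FluidPDE

/-! ## §1. The near-`1` bound for the regularised Hessian convolutions -/

section HessConvLp

/-- **`L^p` bound for the regularised Hessian convolutions near `p = 1`, uniform in the scale**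
(Stein 1970, Ch. II §6.2 (a) for the kernels `k^a_ε = ∂ₐ∂ₐΦ_ε`): there is ONE `C` with
`‖H^a_ε[h]‖_p ≤ C (p−1)⁻¹ ‖h‖_p` for all `1 < p ≤ 2`, `ε > 0`, `|a| ≤ 2` and `h ∈ C_c(ℝ³)` (the
uniform near-`1` Calderón–Zygmund theorem `SingularIntegrals.exists_eLpNorm_le_near_one` with the
`L²` bound `eLpNorm_hessConv_le` and the Hörmander bound `exists_hormander_bound_hessKernel`).
[cite: Stein1971, Ch. II §6.2 (a)] -/
theorem exists_eLpNorm_hessConv_le_near_one :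
    ∃ C : ℝ≥0, ∀ p : ℝ≥0∞, 1 < p → p ≤ 2 → ∀ ε : ℝ, 0 < ε →
      ∀ a : (EuclideanSpace ℝ (Fin 3)), ‖a‖ ≤ 2 →
      ∀ h : (EuclideanSpace ℝ (Fin 3)) → ℝ, Continuous h → HasCompactSupport h →
        eLpNorm (hessConv ε h a) p volume ≤ (C : ℝ≥0∞) / (p - 1) * eLpNorm h p volume := by
  obtain ⟨M, hM0, hM⟩ := exists_bound_fderiv_fderiv_newtonReg
  obtain ⟨B, hB⟩ := exists_hormander_bound_hessKernel
  set A₀ : ℝ≥0 := (4 * regLaplacianMass).toNNReal with hA₀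
  obtain ⟨C, hC⟩ := SingularIntegrals.exists_eLpNorm_le_near_one.{0} 3 A₀ B
  refine ⟨C, fun p hp1 hp2 ε hε a ha h hh hhc => ?_⟩
  have ha2 : ‖a‖ ^ 2 ≤ 4 := by nlinarith [norm_nonneg a]
  -- the kernel `k^a_ε`, its measurability and sup bound
  have hkm : Measurable fun z : (EuclideanSpace ℝ (Fin 3)) =>
      fderiv ℝ (fun s => fderiv ℝ (newtonReg ε) s a) z a :=
    (continuous_hessKernel ε a).measurable
  have hkb : ∃ M' : ℝ, ∀ z : (EuclideanSpace ℝ (Fin 3)),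
      |fderiv ℝ (fun s => fderiv ℝ (newtonReg ε) s a) z a| ≤ M' :=
    ⟨ε⁻¹ ^ 3 * M * ‖a‖ ^ 2, fun z => abs_hessKernel_le hM hε a z⟩
  -- the `L²` bound on continuous compactly supported functions
  have hL2 : ∀ g : (EuclideanSpace ℝ (Fin 3)) → ℝ, Continuous g → HasCompactSupport g →
      eLpNorm (fun x => ∫ t, g t * fderiv ℝ (fun s => fderiv ℝ (newtonReg ε) s a) (x - t) a) 2 volume ≤
        A₀ * eLpNorm g 2 volume := by
    intro g hg hgc
    have hA₀' : (A₀ : ℝ≥0∞) = ENNReal.ofReal (4 * regLaplacianMass) := rfl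
    calc eLpNorm (fun x => ∫ t, g t * fderiv ℝ (fun s => fderiv ℝ (newtonReg ε) s a) (x - t) a) 2 volume
        = eLpNorm (hessConv ε g a) 2 volume := rfl
      _ ≤ ENNReal.ofReal (‖a‖ ^ 2) * (ENNReal.ofReal regLaplacianMass * eLpNorm g 2 volume) :=
          eLpNorm_hessConv_le hε hg hgc a
      _ = ENNReal.ofReal (‖a‖ ^ 2 * regLaplacianMass) * eLpNorm g 2 volume := by
          rw [ENNReal.ofReal_mul (by positivity), mul_assoc]
      _ ≤ A₀ * eLpNorm g 2 volume := by
          rw [hA₀']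
          gcongr
          exact regLaplacianMass_nonneg
  -- a sup bound for `h`
  have hhb : ∃ C' : ℝ, ∀ x, |h x| ≤ C' := by
    obtain ⟨C', hC'⟩ := hh.bounded_above_of_compact_support hhc
    exact ⟨C', fun x => by rw [← Real.norm_eq_abs]; exact hC' x⟩
  exact hC (E := (EuclideanSpace ℝ (Fin 3))) volume finrank_euclideanSpace_fin hkm hkb hL2 (hB ε hε a ha)
    p hp1 hp2 h hh.measurable hhb hhc

end HessConvLp

/-! ## §2. Polarisation, parametric in the Hessian-convolution constant -/

section Assembly

variable {w : (EuclideanSpace ℝ (Fin 3)) → (EuclideanSpace ℝ (Fin 3))}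

/-- **`L^p` bound for the regularised pressure from a bound for the Hessian convolutions**
(polarisation `Q_ε = -½Σᵢⱼ(H^{bᵢ+bⱼ} − H^{bᵢ} − H^{bⱼ})[wᵢwⱼ]`, `|wᵢwⱼ| ≤ |w|²`, with
`|bᵢ + bⱼ| ≤ 2`; the proof of `exists_eLpNorm_regPressure_le` made parametric in the constant):
if `‖H^a_ε[h]‖_p ≤ K‖h‖_p` for all `|a| ≤ 2` and `h ∈ C_c(ℝ³)` (`1 ≤ p`, `ε` fixed), then
`‖Q_ε[w]‖_p ≤ 27K ‖|w|²‖_p` for `w ∈ C_c(ℝ³; ℝ³)`. [cite: Stein1971, Ch. II §4.2 Thm 3] -/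
theorem eLpNorm_regPressure_le_of_hessConv_le {p : ℝ≥0∞} (hp1 : 1 ≤ p) {ε : ℝ} {K : ℝ≥0∞}
    (hK : ∀ a : (EuclideanSpace ℝ (Fin 3)), ‖a‖ ≤ 2 →
      ∀ h : (EuclideanSpace ℝ (Fin 3)) → ℝ, Continuous h → HasCompactSupport h →
        eLpNorm (hessConv ε h a) p volume ≤ K * eLpNorm h p volume)
    (hw : Continuous w) (hwc : HasCompactSupport w) :
    eLpNorm (regPressure ε w) p volume ≤ 27 * K * eLpNorm (fun y => ‖w y‖ ^ 2) p volume := by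
  set b := stdOrthonormalBasis ℝ (EuclideanSpace ℝ (Fin 3))
  set N : ℝ≥0∞ := eLpNorm (fun y => ‖w y‖ ^ 2) p volume with hN
  have hfun : regPressure ε w = -((2⁻¹ : ℝ) • fun x => ∑ i, ∑ j,
      (hessConv ε (coordProd w i j) (b i + b j) x - hessConv ε (coordProd w i j) (b i) x -
        hessConv ε (coordProd w i j) (b j) x)) := by
    funext x
    simp only [Pi.neg_apply, Pi.smul_apply, smul_eq_mul]
    exact regPressure_eq_sum_hessConv ε hw hwc x
  -- the `L^p` norm of each `wᵢwⱼ` is at most that of `|w|²`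
  have hcp : ∀ i j, eLpNorm (coordProd w i j) p volume ≤ N := fun i j =>
    eLpNorm_mono_real fun y => by
      rw [Real.norm_eq_abs]
      exact abs_coordProd_le w i j y
  -- norms of the directions
  have hb1 : ∀ i, ‖b i‖ ≤ 2 := fun i => by rw [b.orthonormal.1]; norm_num
  have hb2 : ∀ i j, ‖b i + b j‖ ≤ 2 := fun i j =>
    (norm_add_le _ _).trans (by rw [b.orthonormal.1, b.orthonormal.1]; norm_num)
  -- each Hessian convolution
  have hH : ∀ (i j) (u : (EuclideanSpace ℝ (Fin 3))), ‖u‖ ≤ 2 →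
      eLpNorm (hessConv ε (coordProd w i j) u) p volume ≤ K * N :=
    fun i j u hu => (hK u hu (coordProd w i j) (continuous_coordProd hw i j)
      (hasCompactSupport_coordProd hwc i j)).trans (by gcongr; exact hcp i j)
  have hm : ∀ (i j) (u : (EuclideanSpace ℝ (Fin 3))),
      AEStronglyMeasurable (hessConv ε (coordProd w i j) u) volume :=
    fun i j u => aestronglyMeasurable_hessConv ε (continuous_coordProd hw i j) u
  -- each `(i, j)` term
  have hterm : ∀ i j, eLpNorm (fun x => hessConv ε (coordProd w i j) (b i + b j) x -
      hessConv ε (coordProd w i j) (b i) x - hessConv ε (coordProd w i j) (b j) x) p volume ≤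
      3 * (K * N) := by
    intro i j
    calc eLpNorm (fun x => hessConv ε (coordProd w i j) (b i + b j) x -
          hessConv ε (coordProd w i j) (b i) x - hessConv ε (coordProd w i j) (b j) x) p volume
        ≤ eLpNorm (fun x => hessConv ε (coordProd w i j) (b i + b j) x -
            hessConv ε (coordProd w i j) (b i) x) p volume +
            eLpNorm (hessConv ε (coordProd w i j) (b j)) p volume :=
          eLpNorm_sub_le ((hm i j _).sub (hm i j _)) (hm i j _) hp1
      _ ≤ (eLpNorm (hessConv ε (coordProd w i j) (b i + b j)) p volume +
            eLpNorm (hessConv ε (coordProd w i j) (b i)) p volume) +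
            eLpNorm (hessConv ε (coordProd w i j) (b j)) p volume := by
          gcongr
          exact eLpNorm_sub_le (hm i j _) (hm i j _) hp1
      _ ≤ (K * N + K * N) + K * N := by
          gcongr
          · exact hH i j _ (hb2 i j)
          · exact hH i j _ (hb1 i)
          · exact hH i j _ (hb1 j)
      _ = 3 * (K * N) := by ring
  -- sum and constants
  rw [hfun, eLpNorm_neg, eLpNorm_const_smul]
  have hsum : eLpNorm (∑ i, ∑ j, fun x => hessConv ε (coordProd w i j) (b i + b j) x -
      hessConv ε (coordProd w i j) (b i) x - hessConv ε (coordProd w i j) (b j) x) p volume ≤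
      (9 : ℕ) • (3 * (K * N)) := by
    calc eLpNorm (∑ i, ∑ j, fun x => hessConv ε (coordProd w i j) (b i + b j) x -
          hessConv ε (coordProd w i j) (b i) x - hessConv ε (coordProd w i j) (b j) x) p volume
        ≤ ∑ i, eLpNorm (∑ j, fun x => hessConv ε (coordProd w i j) (b i + b j) x -
            hessConv ε (coordProd w i j) (b i) x - hessConv ε (coordProd w i j) (b j) x) p volume :=
          eLpNorm_sum_le (fun i _ => Finset.aestronglyMeasurable_sum _ fun j _ =>
            ((hm i j _).sub (hm i j _)).sub (hm i j _)) hp1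
      _ ≤ ∑ i, ∑ j, eLpNorm (fun x => hessConv ε (coordProd w i j) (b i + b j) x -
            hessConv ε (coordProd w i j) (b i) x - hessConv ε (coordProd w i j) (b j) x) p volume :=
          Finset.sum_le_sum fun i _ => eLpNorm_sum_le (fun j _ =>
            ((hm i j _).sub (hm i j _)).sub (hm i j _)) hp1
      _ ≤ ∑ _i : Fin (Module.finrank ℝ (EuclideanSpace ℝ (Fin 3))),
            ∑ _j : Fin (Module.finrank ℝ (EuclideanSpace ℝ (Fin 3))), 3 * (K * N) :=
          Finset.sum_le_sum fun i _ => Finset.sum_le_sum fun j _ => hterm i j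
      _ = (9 : ℕ) • (3 * (K * N)) := by
          rw [Finset.sum_const, Finset.sum_const, Finset.card_univ, Fintype.card_fin,
            finrank_euclideanSpace_fin, smul_smul]
          rfl
  have hfun2 : (∑ i, ∑ j, fun x => hessConv ε (coordProd w i j) (b i + b j) x -
      hessConv ε (coordProd w i j) (b i) x - hessConv ε (coordProd w i j) (b j) x) =
      fun x => ∑ i, ∑ j, (hessConv ε (coordProd w i j) (b i + b j) x -
        hessConv ε (coordProd w i j) (b i) x - hessConv ε (coordProd w i j) (b j) x) := by
    funext x
    simp only [Finset.sum_apply]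
  rw [hfun2] at hsum
  have h2 : ‖(2⁻¹ : ℝ)‖ₑ ≤ 1 := by
    rw [Real.enorm_eq_ofReal (by norm_num)]
    exact ENNReal.ofReal_le_one.2 (by norm_num)
  calc ‖(2⁻¹ : ℝ)‖ₑ * eLpNorm (fun x => ∑ i, ∑ j, (hessConv ε (coordProd w i j) (b i + b j) x -
        hessConv ε (coordProd w i j) (b i) x - hessConv ε (coordProd w i j) (b j) x)) p volume
      ≤ 1 * ((9 : ℕ) • (3 * (K * N))) := mul_le_mul' h2 hsum
    _ = 27 * K * N := by
        rw [one_mul, nsmul_eq_mul]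
        push_cast
        ring

/-! ## §3. The theorem: Fatou along `ε = 1/(n+1)` -/

/-- **The `L^p` bound for the normalised pressure near `p = 1`** (Stein 1970, Ch. II §6.2 (a),
first clause, for the Riesz-type kernels of the normalised pressure; the `(p−1)⁻¹` form of
`stein1970_normalisedPressure_Lp_bound`): there is ONE constant `C₀` such that for every
`1 < p ≤ 2` and every `w ∈ C^∞_c(ℝ³; ℝ³)`,
`‖p̃[w]‖_{L^p} ≤ C₀ (p − 1)⁻¹ ‖|w|²‖_{L^p}` (`p̃[w] = lim_ε Q_ε[w]` pointwise, the uniform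
near-`1` bound for `Q_ε[w]`, Fatou). This is literally the statement `SteinNearOne` of the `ns`
instrument «pressure budget with a logarithm». [cite: Stein1971, Ch. II §6.2 (a)] -/
theorem exists_eLpNorm_normalisedPressure_le_near_one :
    ∃ C₀ : ℝ≥0, ∀ p : ℝ≥0∞, 1 < p → p ≤ 2 →
      ∀ w : EuclideanSpace ℝ (Fin 3) → EuclideanSpace ℝ (Fin 3), ContDiff ℝ (⊤ : ℕ∞) w →
        HasCompactSupport w →
        eLpNorm (normalisedPressure w) p volume ≤
          (C₀ : ℝ≥0∞) / (p - 1) * eLpNorm (fun x => ‖w x‖ ^ 2) p volume := by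
  obtain ⟨C, hC⟩ := exists_eLpNorm_hessConv_le_near_one
  refine ⟨27 * C, fun p hp1 hp2 w hw hwc => ?_⟩
  -- the uniform bound for the regularised pressures
  have hK : ∀ ε : ℝ, 0 < ε → eLpNorm (regPressure ε w) p volume ≤
      27 * ((C : ℝ≥0∞) / (p - 1)) * eLpNorm (fun y => ‖w y‖ ^ 2) p volume := fun ε hε =>
    eLpNorm_regPressure_le_of_hessConv_le hp1.le
      (fun a ha h hh hhc => hC p hp1 hp2 ε hε a ha h hh hhc) hw.continuous hwc
  have hconst : (27 : ℝ≥0∞) * ((C : ℝ≥0∞) / (p - 1)) = ((27 * C : ℝ≥0) : ℝ≥0∞) / (p - 1) := by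
    push_cast
    rw [mul_div_assoc]
  -- Fatou along `ε = 1/(n+1)`
  have hfun : normalisedPressure w = limPressure w := funext (normalisedPressure_eq_limPressure hw hwc)
  rw [hfun]
  have hFatou := Lp.eLpNorm_lim_le_liminf_eLpNorm (μ := volume) (p := p)
    (f := fun n : ℕ => regPressure (1 / ((n : ℝ) + 1)) w)
    (fun n => aestronglyMeasurable_regPressure (1 / ((n : ℝ) + 1)) hw.continuous hwc)
    (limPressure w) (Eventually.of_forall fun x => tendsto_regPressure_nat hw hwc x)
  refine hFatou.trans (liminf_le_of_frequently_le' (Eventually.of_forall fun n => ?_).frequently)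
  rw [← hconst]
  exact hK _ (one_div_pos.2 (Nat.cast_add_one_pos n))

/-- **The same bound at `p = 1 + s`, `0 < s ≤ 1`, with the constant written `C₀ s⁻¹`:**
`‖p̃[w]‖_{L^{1+s}} ≤ C₀ s⁻¹ ‖|w|²‖_{L^{1+s}}` for all `w ∈ C^∞_c(ℝ³; ℝ³)` (the form consumed by the
`L log L` optimisation `s = 1/log(…)`, Stein 1970, Ch. II §6.2 (b)). [cite: Stein1971, Ch. II §6.2 (a)] -/
theorem exists_eLpNorm_normalisedPressure_le_one_add :
    ∃ C₀ : ℝ≥0, ∀ s : ℝ, 0 < s → s ≤ 1 →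
      ∀ w : EuclideanSpace ℝ (Fin 3) → EuclideanSpace ℝ (Fin 3), ContDiff ℝ (⊤ : ℕ∞) w →
        HasCompactSupport w →
        eLpNorm (normalisedPressure w) (ENNReal.ofReal (1 + s)) volume ≤
          (C₀ : ℝ≥0∞) * ENNReal.ofReal s⁻¹ *
            eLpNorm (fun x => ‖w x‖ ^ 2) (ENNReal.ofReal (1 + s)) volume := by
  obtain ⟨C₀, hC₀⟩ := exists_eLpNorm_normalisedPressure_le_near_one
  refine ⟨C₀, fun s hs hs1 w hw hwc => ?_⟩
  have hp1 : 1 < ENNReal.ofReal (1 + s) := by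
    rw [← ENNReal.ofReal_one]
    exact (ENNReal.ofReal_lt_ofReal_iff (by linarith)).2 (by linarith)
  have hp2 : ENNReal.ofReal (1 + s) ≤ 2 := by
    rw [← ENNReal.ofReal_ofNat 2]
    exact ENNReal.ofReal_le_ofReal (by linarith)
  have hsub : ENNReal.ofReal (1 + s) - 1 = ENNReal.ofReal s := by
    rw [← ENNReal.ofReal_one, ← ENNReal.ofReal_sub (1 + s) zero_le_one, add_sub_cancel_left]
  have hconst : (C₀ : ℝ≥0∞) / (ENNReal.ofReal (1 + s) - 1) = (C₀ : ℝ≥0∞) * ENNReal.ofReal s⁻¹ := by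
    rw [hsub, div_eq_mul_inv, ENNReal.ofReal_inv_of_pos hs]
  have h := hC₀ (ENNReal.ofReal (1 + s)) hp1 hp2 w hw hwc
  rwa [hconst] at h

end Assembly

end Literature.Analysis.FluidPDE

end
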